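import Summits.FinalStateConjecture.FinalStateConjecture.Theorems.EIHFluxBalanceInertialRecessionSlavingAxisData
import Summits.FinalStateConjecture.FinalStateConjecture.Theorems.EIHFluxBalanceInertialRecessionSlavingSpatialRigidity

/-!
# Route EIHFluxBalance — `InertialRecession` (E′), stub `stub_frozenVacuumSlaving` (K1): the KERNEL of
# the first-variation map of the Kerr–Schild form at THREE axis points is the stabiliser (all spins)

Helper file for the crux `stmt-FinalStateConjecture-17403` (evidence `K1_linear_architecture.md`,
`K1_seat1_claims.md`). The first variation of the rest-frame Kerr–Schild form `g = Kerr.bilin M a` along an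
infinitesimal Poincaré motion `Z(y) = A y + d` (`A` `η`-skew) is
`𝓛_Z g (y)(u, w) = ∂_{Z(y)} g(y)(u, w) + g(y)(A u, w) + g(y)(u, A w)`. At an axis point `y = (t,0,0,z)` its
`(e₀, e_ν)` components are (`…SlavingAxisData` tables; the `η`-parts of the `A`-terms cancel):
`ν = 0`: `2 V³ ∂₃H + 4H ε b₃`; `ν = 1`: `2H(α V¹ + β V² + b₁ − ε ω₂)`; `ν = 2`: `2H(−β V¹ + α V² + b₂ + ε ω₁)`
(`V = Z(y)`, `b = A e₀` the boost rate, `ω₂ = (A e₃)¹`, `−ω₁ = (A e₃)²` the non-axial rotation rates,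
`ε = z/|z|`). Main result `axisKernel_three_points`: if these components vanish at `(t₁,0,0,z₁)`, `(t₂,0,0,z₂)`
(`z₁, z₂ > 0`) and `(t₃,0,0,z₃)` (`z₃ < 0`) with `t₁ + z₁ ≠ t₂ + z₂` and the `2 × 2` condition
`(1 + κ₁t₁)κ₂ ≠ (1 + κ₂t₂)κ₁`, `κ_k = (a² − z_k²)/(2 z_k (z_k² + a²))`, then `A e₀ = 0`, `d¹ = d² = d³ = 0`, and
`a ≠ 0 → A e₃ = 0`: `Z` is in the stabiliser (rest time translation, axial rotation). On a lab slab the rest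
times are forced, `t_k = −v₃ z_k`; both conditions then hold for `z₂ > z₁ ≥ 3|a|` and every `|v₃| < 1`
(note in the evidence file). Literature + `…SlavingAxisData` only; no definitions, no `sorry`. [folklore]
-/

set_option linter.dupNamespace false

noncomputable section

open scoped Topology
open Filter Set Function Literature.Geometry.Lorentzian Literature.Geometry.Lorentzian.Kerr

namespace Summit.FinalStateConjecture.FinalStateConjecture.Theorems.SublinearIsFree.Slaving

/-! ### The `(e₀, e_ν)` components of the first variation at an axis point -/

section Components

variable {M a : ℝ} {y : E4} (h1 : y 1 = 0) (h2 : y 2 = 0) (hz : y 3 ≠ 0)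
  (A : E4 →L[ℝ] E4) (hA : ∀ u w : E4, Minkowski.bilin (A u) w + Minkowski.bilin u (A w) = 0)

include h1 h2 in
/-- `ℓ(u) = u⁰ + ε u³` at an axis point. [folklore] -/
theorem axis_nullCovector_apply (u : E4) :
    nullCovector a y u = u 0 + y 3 / |y 3| * u 3 := by
  rw [covector_apply_eq_sum, Fin.sum_univ_four]
  simp only [nullCovector_basisVector, axis_nullCovectorFun (a := a) h1 h2]
  simp

include hA in
/-- `η`-skewness in components: `(A e₀)⁰ = 0`. [folklore] -/
theorem skew_apply_zero_zero : A (E4.basisVector 0) 0 = 0 := by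
  have h := hA (E4.basisVector 0) (E4.basisVector 0)
  rw [Minkowski.bilin_symm (A _) (E4.basisVector 0), Minkowski.bilin_basisVector_zero_left] at h
  linarith

include hA in
/-- `η`-skewness in components: `(A e_i)⁰ = (A e₀)^i` for spatial `i`. [folklore] -/
theorem skew_apply_succ_zero (i : Fin 3) : A (E4.basisVector i.succ) 0 = A (E4.basisVector 0) i.succ := by
  have h := hA (E4.basisVector 0) (E4.basisVector i.succ)
  rw [minkowski_basisVector_succ, Minkowski.bilin_basisVector_zero_left] at h
  linarith

include hA in
/-- `η`-skewness in components: `(A e_i)^j = −(A e_j)^i` for spatial `i, j`. [folklore] -/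
theorem skew_apply_succ_succ (i j : Fin 3) :
    A (E4.basisVector i.succ) j.succ = -A (E4.basisVector j.succ) i.succ := by
  have h := hA (E4.basisVector i.succ) (E4.basisVector j.succ)
  rw [minkowski_basisVector_succ, Minkowski.bilin_symm (E4.basisVector i.succ), minkowski_basisVector_succ] at h
  linarith

/-- The directional derivative is the sum of the partials: `∂_V f = Σ_c V^c ∂_c f`. [folklore] -/
theorem fderiv_apply_eq_sum_E4 {F : Type*} [NormedAddCommGroup F] [NormedSpace ℝ F] (f : E4 → F) (x V : E4) :
    fderiv ℝ f x V = ∑ c, V c • fderiv ℝ f x (E4.basisVector c) := by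
  conv_lhs => rw [Kerr.eq_sum_basisVector V]
  simp [map_sum, map_smul]

include h1 h2 hz hA in
/-- **The `(e₀, e_ν)` components of `𝓛_Z g` at an axis point.** With `V` the direction of differentiation:
`(e₀,e₀)`: `2V³∂₃H + 4Hε(Ae₀)³`; `(e₀,e₁)`: `2H(αV¹ + βV² + (Ae₀)¹ + ε(Ae₁)³)`;
`(e₀,e₂)`: `2H(−βV¹ + αV² + (Ae₀)² + ε(Ae₂)³)`, with the axis values of `H, ∂₃H, α, β`. [folklore] -/
theorem axis_lie_components (V : E4) :
    (fderiv ℝ (Kerr.bilin M a) y V (E4.basisVector 0) (E4.basisVector 0) +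
        Kerr.bilin M a y (A (E4.basisVector 0)) (E4.basisVector 0) +
        Kerr.bilin M a y (E4.basisVector 0) (A (E4.basisVector 0)) =
      2 * V 3 * (M * (y 3 / |y 3|) * (a ^ 2 - y 3 ^ 2) / (y 3 ^ 2 + a ^ 2) ^ 2) +
        4 * (M * |y 3| / (y 3 ^ 2 + a ^ 2)) * (y 3 / |y 3| * A (E4.basisVector 0) 3)) ∧
    (fderiv ℝ (Kerr.bilin M a) y V (E4.basisVector 0) (E4.basisVector 1) +
        Kerr.bilin M a y (A (E4.basisVector 0)) (E4.basisVector 1) +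
        Kerr.bilin M a y (E4.basisVector 0) (A (E4.basisVector 1)) =
      2 * (M * |y 3| / (y 3 ^ 2 + a ^ 2)) * (|y 3| / (y 3 ^ 2 + a ^ 2) * V 1 + a / (y 3 ^ 2 + a ^ 2) * V 2 +
        A (E4.basisVector 0) 1 + y 3 / |y 3| * A (E4.basisVector 1) 3)) ∧
    (fderiv ℝ (Kerr.bilin M a) y V (E4.basisVector 0) (E4.basisVector 2) +
        Kerr.bilin M a y (A (E4.basisVector 0)) (E4.basisVector 2) +
        Kerr.bilin M a y (E4.basisVector 0) (A (E4.basisVector 2)) =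
      2 * (M * |y 3| / (y 3 ^ 2 + a ^ 2)) * (-(a / (y 3 ^ 2 + a ^ 2)) * V 1 + |y 3| / (y 3 ^ 2 + a ^ 2) * V 2 +
        A (E4.basisVector 0) 2 + y 3 / |y 3| * A (E4.basisVector 2) 3)) := by
  have hx := axis_radius_pos (a := a) h1 h2 hz
  have hH := axis_scalarH (M := M) (a := a) h1 h2 hz
  have hdH := axis_fderiv_scalarH (M := M) (a := a) h1 h2 hz
  have hdl := axis_fderiv_nullCovectorFun (a := a) h1 h2 hz
  have hl := axis_nullCovectorFun (a := a) h1 h2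
  have hb0 := skew_apply_zero_zero A hA
  have hs1 := skew_apply_succ_zero A hA 0
  have hs2 := skew_apply_succ_zero A hA 1
  have hA00 := hA (E4.basisVector 0) (E4.basisVector 0)
  have hA01 := hA (E4.basisVector 0) (E4.basisVector 1)
  have hA02 := hA (E4.basisVector 0) (E4.basisVector 2)
  simp only [Fin.succ_zero_eq_one, Fin.succ_one_eq_two] at hs1 hs2
  -- expand the directional derivative and every metric value
  have key : ∀ ν : Fin 4, fderiv ℝ (Kerr.bilin M a) y V (E4.basisVector 0) (E4.basisVector ν) =
      ∑ c, V c * (2 * fderiv ℝ (scalarH M a) y (E4.basisVector c) * nullCovectorFun a y 0 *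
        nullCovectorFun a y ν + 2 * scalarH M a y *
          (fderiv ℝ (fun x ↦ nullCovectorFun a x 0) y (E4.basisVector c) * nullCovectorFun a y ν +
            nullCovectorFun a y 0 * fderiv ℝ (fun x ↦ nullCovectorFun a x ν) y (E4.basisVector c))) := by
    intro ν
    rw [fderiv_apply_eq_sum_E4 (Kerr.bilin M a) y V]
    simp [fderiv_bilin_basisVector M a hx]
  refine ⟨?_, ?_, ?_⟩
  · rw [key 0, Kerr.bilin_apply, Kerr.bilin_apply,
      axis_nullCovector_apply h1 h2 (A (E4.basisVector 0)), nullCovector_basisVector_zero]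
    simp only [Fin.sum_univ_four, hdH, hdl, hl, hH]
    simp [hb0, Minkowski.bilin_symm _ (E4.basisVector 0)]
    ring
  · have e1 := minkowski_basisVector_succ (A (E4.basisVector 0)) 0
    simp only [Fin.succ_zero_eq_one] at e1
    rw [key 1, Kerr.bilin_apply, Kerr.bilin_apply, e1,
      axis_nullCovector_apply h1 h2 (A (E4.basisVector 0)),
      axis_nullCovector_apply h1 h2 (A (E4.basisVector 1)), nullCovector_basisVector,
      nullCovector_basisVector]
    simp only [Fin.sum_univ_four, hdH, hdl, hl, hH]
    simp [hs1, hb0]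
    ring
  · have e2 := minkowski_basisVector_succ (A (E4.basisVector 0)) 1
    simp only [Fin.succ_one_eq_two] at e2
    rw [key 2, Kerr.bilin_apply, Kerr.bilin_apply, e2,
      axis_nullCovector_apply h1 h2 (A (E4.basisVector 0)),
      axis_nullCovector_apply h1 h2 (A (E4.basisVector 2)), nullCovector_basisVector,
      nullCovector_basisVector]
    simp only [Fin.sum_univ_four, hdH, hdl, hl, hH]
    simp [hs2, hb0]
    ring

end Components

/-! ### The kernel at three axis points -/

section Kernel

variable {M a : ℝ} (A : E4 →L[ℝ] E4) (d : E4)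

/-- `(A P)^j = P⁰ (A e₀)^j + P³ (A e₃)^j` at an axis point `P`. [folklore] -/
theorem apply_axis_point (P : E4) (h1 : P 1 = 0) (h2 : P 2 = 0) (j : Fin 4) :
    A P j = P 0 * A (E4.basisVector 0) j + P 3 * A (E4.basisVector 3) j := by
  conv_lhs => rw [Kerr.eq_sum_basisVector P]
  simp [map_smul, Fin.sum_univ_four, h1, h2]

/-- **Kernel lemma at three axis points (all spins).** Let `A` be `η`-skew, `d ∈ E4`, `M ≠ 0`, and let the
`(e₀, e_ν)` components of the first variation `∂_{AP+d} g_{M,a}(P) + g(P)(A·, ·) + g(P)(·, A·)` vanish at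
three axis points `P₁ = (t₁,0,0,z₁)`, `P₂ = (t₂,0,0,z₂)` (`z₁, z₂ > 0`), `P₃ = (t₃,0,0,z₃)` (`z₃ < 0`) with
`t₁ + z₁ ≠ t₂ + z₂` and `(2z₁(z₁²+a²) + (a²−z₁²)t₁)(a²−z₂²) ≠ (2z₂(z₂²+a²) + (a²−z₂²)t₂)(a²−z₁²)`. Then the
boost rate vanishes (`A e₀ = 0`), the centre rate is a rest time translation (`d¹ = d² = d³ = 0`), and for
`a ≠ 0` the axis is fixed (`A e₃ = 0`). [folklore] -/
theorem axisKernel_three_points (hM : M ≠ 0)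
    (hA : ∀ u w : E4, Minkowski.bilin (A u) w + Minkowski.bilin u (A w) = 0)
    (P₁ P₂ P₃ : E4) (h11 : P₁ 1 = 0) (h12 : P₁ 2 = 0) (hz1 : 0 < P₁ 3)
    (h21 : P₂ 1 = 0) (h22 : P₂ 2 = 0) (hz2 : 0 < P₂ 3)
    (h31 : P₃ 1 = 0) (h32 : P₃ 2 = 0) (hz3 : P₃ 3 < 0)
    (hG1 : P₁ 0 + P₁ 3 ≠ P₂ 0 + P₂ 3)
    (hG2 : (2 * P₁ 3 * (P₁ 3 ^ 2 + a ^ 2) + (a ^ 2 - P₁ 3 ^ 2) * P₁ 0) * (a ^ 2 - P₂ 3 ^ 2) ≠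
      (2 * P₂ 3 * (P₂ 3 ^ 2 + a ^ 2) + (a ^ 2 - P₂ 3 ^ 2) * P₂ 0) * (a ^ 2 - P₁ 3 ^ 2))
    (hvan : ∀ P ∈ ({P₁, P₂, P₃} : Set E4), ∀ ν : Fin 4,
      fderiv ℝ (Kerr.bilin M a) P (A P + d) (E4.basisVector 0) (E4.basisVector ν) +
        Kerr.bilin M a P (A (E4.basisVector 0)) (E4.basisVector ν) +
        Kerr.bilin M a P (E4.basisVector 0) (A (E4.basisVector ν)) = 0) :
    A (E4.basisVector 0) = 0 ∧ d 1 = 0 ∧ d 2 = 0 ∧ d 3 = 0 ∧ (a ≠ 0 → A (E4.basisVector 3) = 0) := by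
  -- names for the components
  set b1 := A (E4.basisVector 0) 1 with hb1
  set b2 := A (E4.basisVector 0) 2 with hb2
  set b3 := A (E4.basisVector 0) 3 with hb3
  set w13 := A (E4.basisVector 1) 3 with hw13
  set w23 := A (E4.basisVector 2) 3 with hw23
  have hb0 := skew_apply_zero_zero A hA
  have h30 : A (E4.basisVector 3) 0 = b3 := by
    have := skew_apply_succ_zero A hA 2; simpa using this
  have h31' : A (E4.basisVector 3) 1 = -w13 := by
    have := skew_apply_succ_succ A hA 2 0; simpa using this
  have h32' : A (E4.basisVector 3) 2 = -w23 := by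
    have := skew_apply_succ_succ A hA 2 1; simpa using this
  have h33 : A (E4.basisVector 3) 3 = 0 := by
    have := skew_apply_succ_succ A hA 2 2
    simp only [show (2 : Fin 3).succ = (3 : Fin 4) from rfl] at this
    linarith
  -- the components of V = A P + d at an axis point
  have hV : ∀ P : E4, P 1 = 0 → P 2 = 0 →
      (A P + d) 1 = P 0 * b1 - P 3 * w13 + d 1 ∧ (A P + d) 2 = P 0 * b2 - P 3 * w23 + d 2 ∧
        (A P + d) 3 = P 0 * b3 + d 3 := by
    intro P hP1 hP2
    refine ⟨?_, ?_, ?_⟩ <;> simp only [PiLp.add_apply, apply_axis_point A P hP1 hP2] <;>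
      simp [h31', h32', h33, hb1, hb2, hb3] <;> ring
  -- the scalar equations at a point with z > 0 (ε = 1) …
  have pos : ∀ P : E4, P 1 = 0 → P 2 = 0 → 0 < P 3 → P ∈ ({P₁, P₂, P₃} : Set E4) →
      (P 0 + P 3) * b1 + d 1 - a * (b2 + w23) = 0 ∧ (P 0 + P 3) * b2 + d 2 + a * (b1 + w13) = 0 ∧
        b3 * (2 * P 3 * (P 3 ^ 2 + a ^ 2) + (a ^ 2 - P 3 ^ 2) * P 0) + (a ^ 2 - P 3 ^ 2) * d 3 = 0 := by
    intro P hP1 hP2 hPz hPm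
    have hz : P 3 ≠ 0 := hPz.ne'
    obtain ⟨c0, c1, c2⟩ := axis_lie_components (M := M) (a := a) hP1 hP2 hz A hA (A P + d)
    rw [hvan P hPm 0] at c0; rw [hvan P hPm 1] at c1; rw [hvan P hPm 2] at c2
    obtain ⟨v1, v2, v3⟩ := hV P hP1 hP2
    rw [v3] at c0; rw [v1, v2] at c1 c2
    have habs : |P 3| = P 3 := abs_of_pos hPz
    have hone : P 3 / |P 3| = 1 := by rw [habs, div_self hz]
    rw [hone, habs] at c0 c1 c2
    have hD : P 3 ^ 2 + a ^ 2 ≠ 0 := by positivity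
    have hH : 2 * (M * P 3 / (P 3 ^ 2 + a ^ 2)) ≠ 0 :=
      mul_ne_zero two_ne_zero (div_ne_zero (mul_ne_zero hM hz) hD)
    have i1 := (mul_eq_zero.1 c1.symm).resolve_left hH
    have i2 := (mul_eq_zero.1 c2.symm).resolve_left hH
    have e1m : P 3 * (P 0 * b1 - P 3 * w13 + d 1) + a * (P 0 * b2 - P 3 * w23 + d 2) +
        (P 3 ^ 2 + a ^ 2) * (b1 + w13) = 0 := by
      have : P 3 * (P 0 * b1 - P 3 * w13 + d 1) + a * (P 0 * b2 - P 3 * w23 + d 2) +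
          (P 3 ^ 2 + a ^ 2) * (b1 + w13) = (P 3 ^ 2 + a ^ 2) *
          (P 3 / (P 3 ^ 2 + a ^ 2) * (P 0 * b1 - P 3 * w13 + d 1) +
            a / (P 3 ^ 2 + a ^ 2) * (P 0 * b2 - P 3 * w23 + d 2) + b1 + 1 * w13) := by
        field_simp; ring
      rw [this, i1, mul_zero]
    have e2m : -(a * (P 0 * b1 - P 3 * w13 + d 1)) + P 3 * (P 0 * b2 - P 3 * w23 + d 2) +
        (P 3 ^ 2 + a ^ 2) * (b2 + w23) = 0 := by
      have : -(a * (P 0 * b1 - P 3 * w13 + d 1)) + P 3 * (P 0 * b2 - P 3 * w23 + d 2) +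
          (P 3 ^ 2 + a ^ 2) * (b2 + w23) = (P 3 ^ 2 + a ^ 2) *
          (-(a / (P 3 ^ 2 + a ^ 2)) * (P 0 * b1 - P 3 * w13 + d 1) +
            P 3 / (P 3 ^ 2 + a ^ 2) * (P 0 * b2 - P 3 * w23 + d 2) + b2 + 1 * w23) := by
        field_simp; ring
      rw [this, i2, mul_zero]
    refine ⟨?_, ?_, ?_⟩
    · have h : (P 3 ^ 2 + a ^ 2) * ((P 0 + P 3) * b1 + d 1 - a * (b2 + w23)) = 0 := by
        linear_combination P 3 * e1m - a * e2m
      exact (mul_eq_zero.1 h).resolve_left hD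
    · have h : (P 3 ^ 2 + a ^ 2) * ((P 0 + P 3) * b2 + d 2 + a * (b1 + w13)) = 0 := by
        linear_combination a * e1m + P 3 * e2m
      exact (mul_eq_zero.1 h).resolve_left hD
    · have : b3 * (2 * P 3 * (P 3 ^ 2 + a ^ 2) + (a ^ 2 - P 3 ^ 2) * P 0) + (a ^ 2 - P 3 ^ 2) * d 3 =
          (P 3 ^ 2 + a ^ 2) ^ 2 / (2 * M) * (2 * (P 0 * b3 + d 3) *
            (M * 1 * (a ^ 2 - P 3 ^ 2) / (P 3 ^ 2 + a ^ 2) ^ 2) +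
              4 * (M * P 3 / (P 3 ^ 2 + a ^ 2)) * (1 * b3)) := by
        field_simp; ring
      rw [this, ← c0, mul_zero]
  -- … and at a point with z < 0 (ε = −1)
  have neg : ∀ P : E4, P 1 = 0 → P 2 = 0 → P 3 < 0 → P ∈ ({P₁, P₂, P₃} : Set E4) →
      (P 0 - P 3) * b1 + d 1 - a * (b2 - w23) = 0 ∧ (P 0 - P 3) * b2 + d 2 + a * (b1 - w13) = 0 := by
    intro P hP1 hP2 hPz hPm
    have hz : P 3 ≠ 0 := hPz.ne
    obtain ⟨-, c1, c2⟩ := axis_lie_components (M := M) (a := a) hP1 hP2 hz A hA (A P + d)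
    rw [hvan P hPm 1] at c1; rw [hvan P hPm 2] at c2
    obtain ⟨v1, v2, -⟩ := hV P hP1 hP2
    rw [v1, v2] at c1 c2
    have habs : |P 3| = -P 3 := abs_of_neg hPz
    have hone : P 3 / |P 3| = -1 := by
      rw [habs, div_neg, div_self hz]
    rw [hone, habs] at c1 c2
    have hD : P 3 ^ 2 + a ^ 2 ≠ 0 := by positivity
    have hH : 2 * (M * -P 3 / (P 3 ^ 2 + a ^ 2)) ≠ 0 :=
      mul_ne_zero two_ne_zero (div_ne_zero (mul_ne_zero hM (neg_ne_zero.2 hz)) hD)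
    have i1 := (mul_eq_zero.1 c1.symm).resolve_left hH
    have i2 := (mul_eq_zero.1 c2.symm).resolve_left hH
    have e1m : -P 3 * (P 0 * b1 - P 3 * w13 + d 1) + a * (P 0 * b2 - P 3 * w23 + d 2) +
        (P 3 ^ 2 + a ^ 2) * (b1 - w13) = 0 := by
      have : -P 3 * (P 0 * b1 - P 3 * w13 + d 1) + a * (P 0 * b2 - P 3 * w23 + d 2) +
          (P 3 ^ 2 + a ^ 2) * (b1 - w13) = (P 3 ^ 2 + a ^ 2) *
          (-P 3 / (P 3 ^ 2 + a ^ 2) * (P 0 * b1 - P 3 * w13 + d 1) +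
            a / (P 3 ^ 2 + a ^ 2) * (P 0 * b2 - P 3 * w23 + d 2) + b1 + -1 * w13) := by
        field_simp; ring
      rw [this, i1, mul_zero]
    have e2m : -(a * (P 0 * b1 - P 3 * w13 + d 1)) + -P 3 * (P 0 * b2 - P 3 * w23 + d 2) +
        (P 3 ^ 2 + a ^ 2) * (b2 - w23) = 0 := by
      have : -(a * (P 0 * b1 - P 3 * w13 + d 1)) + -P 3 * (P 0 * b2 - P 3 * w23 + d 2) +
          (P 3 ^ 2 + a ^ 2) * (b2 - w23) = (P 3 ^ 2 + a ^ 2) *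
          (-(a / (P 3 ^ 2 + a ^ 2)) * (P 0 * b1 - P 3 * w13 + d 1) +
            -P 3 / (P 3 ^ 2 + a ^ 2) * (P 0 * b2 - P 3 * w23 + d 2) + b2 + -1 * w23) := by
        field_simp; ring
      rw [this, i2, mul_zero]
    refine ⟨?_, ?_⟩
    · have h : (P 3 ^ 2 + a ^ 2) * ((P 0 - P 3) * b1 + d 1 - a * (b2 - w23)) = 0 := by
        linear_combination (-P 3) * e1m - a * e2m
      exact (mul_eq_zero.1 h).resolve_left hD
    · have h : (P 3 ^ 2 + a ^ 2) * ((P 0 - P 3) * b2 + d 2 + a * (b1 - w13)) = 0 := by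
        linear_combination a * e1m + (-P 3) * e2m
      exact (mul_eq_zero.1 h).resolve_left hD
  -- the linear algebra
  obtain ⟨X1, Y1, E1⟩ := pos P₁ h11 h12 hz1 (by simp)
  obtain ⟨X2, Y2, E2⟩ := pos P₂ h21 h22 hz2 (by simp)
  obtain ⟨X3, Y3⟩ := neg P₃ h31 h32 hz3 (by simp)
  have hb1z : b1 = 0 := by
    have h : (P₁ 0 + P₁ 3 - (P₂ 0 + P₂ 3)) * b1 = 0 := by linear_combination X1 - X2
    exact (mul_eq_zero.1 h).resolve_left (sub_ne_zero.2 hG1)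
  have hb2z : b2 = 0 := by
    have h : (P₁ 0 + P₁ 3 - (P₂ 0 + P₂ 3)) * b2 = 0 := by linear_combination Y1 - Y2
    exact (mul_eq_zero.1 h).resolve_left (sub_ne_zero.2 hG1)
  have hd1 : d 1 = 0 := by
    linear_combination (X1 + X3) / 2 - (P₁ 0 + P₁ 3 + (P₃ 0 - P₃ 3)) / 2 * hb1z + a * hb2z
  have hd2 : d 2 = 0 := by
    linear_combination (Y1 + Y3) / 2 - (P₁ 0 + P₁ 3 + (P₃ 0 - P₃ 3)) / 2 * hb2z - a * hb1z
  have haw23 : a * w23 = 0 := by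
    linear_combination (X3 - X1) / 2 + (P₁ 0 + P₁ 3 - (P₃ 0 - P₃ 3)) / 2 * hb1z
  have haw13 : a * w13 = 0 := by
    linear_combination (Y1 - Y3) / 2 - (P₁ 0 + P₁ 3 - (P₃ 0 - P₃ 3)) / 2 * hb2z
  have hb3z : b3 = 0 := by
    have h : ((2 * P₁ 3 * (P₁ 3 ^ 2 + a ^ 2) + (a ^ 2 - P₁ 3 ^ 2) * P₁ 0) * (a ^ 2 - P₂ 3 ^ 2) -
        (2 * P₂ 3 * (P₂ 3 ^ 2 + a ^ 2) + (a ^ 2 - P₂ 3 ^ 2) * P₂ 0) * (a ^ 2 - P₁ 3 ^ 2)) * b3 = 0 := by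
      linear_combination (a ^ 2 - P₂ 3 ^ 2) * E1 - (a ^ 2 - P₁ 3 ^ 2) * E2
    exact (mul_eq_zero.1 h).resolve_left (sub_ne_zero.2 hG2)
  have hd3 : d 3 = 0 := by
    by_contra hd
    have hN1 : a ^ 2 - P₁ 3 ^ 2 = 0 := by
      have h : (a ^ 2 - P₁ 3 ^ 2) * d 3 = 0 := by linear_combination E1 - (2 * P₁ 3 * (P₁ 3 ^ 2 + a ^ 2) + (a ^ 2 - P₁ 3 ^ 2) * P₁ 0) * hb3z
      exact (mul_eq_zero.1 h).resolve_right hd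
    have hN2 : a ^ 2 - P₂ 3 ^ 2 = 0 := by
      have h : (a ^ 2 - P₂ 3 ^ 2) * d 3 = 0 := by linear_combination E2 - (2 * P₂ 3 * (P₂ 3 ^ 2 + a ^ 2) + (a ^ 2 - P₂ 3 ^ 2) * P₂ 0) * hb3z
      exact (mul_eq_zero.1 h).resolve_right hd
    apply hG2
    rw [hN1, hN2, mul_zero, mul_zero]
  -- conclusions
  refine ⟨?_, hd1, hd2, hd3, fun ha ↦ ?_⟩
  · ext μ
    fin_cases μ
    · simpa using hb0
    · simpa [hb1] using hb1z
    · simpa [hb2] using hb2z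
    · simpa [hb3] using hb3z
  · have hw23z : w23 = 0 := (mul_eq_zero.1 haw23).resolve_left ha
    have hw13z : w13 = 0 := (mul_eq_zero.1 haw13).resolve_left ha
    ext μ
    fin_cases μ
    · simpa [h30] using hb3z
    · simp [h31', hw13z]
    · simp [h32', hw23z]
    · simpa using h33


/-- **Kernel lemma on a lab slab.** On the lab slab of a hole moving with painted velocity `v` the rest times
of the axis points are forced, `t = −v₃ z`; with the three points `(−v₃z, 0, 0, z)`, `(−2v₃z, 0, 0, 2z)`,
`(v₃z, 0, 0, −z)`, `z > 0`, `z ≥ 3|a|`, `|v₃| < 1`, both genericity conditions of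
`axisKernel_three_points` hold, so the vanishing of the `(e₀, e_ν)` components of the first variation there
forces `A e₀ = 0`, `d¹ = d² = d³ = 0` and (`a ≠ 0`) `A e₃ = 0`. [folklore] -/
theorem axisKernel_slab (hM : M ≠ 0)
    (hA : ∀ u w : E4, Minkowski.bilin (A u) w + Minkowski.bilin u (A w) = 0)
    {z v₃ : ℝ} (hz : 0 < z) (hza : 3 * |a| ≤ z) (hv : |v₃| < 1)
    (P₁ P₂ P₃ : E4) (hP₁ : P₁ = ![-(v₃ * z), 0, 0, z]) (hP₂ : P₂ = ![-(v₃ * (2 * z)), 0, 0, 2 * z])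
    (hP₃ : P₃ = ![v₃ * z, 0, 0, -z])
    (hvan : ∀ P ∈ ({P₁, P₂, P₃} : Set E4), ∀ ν : Fin 4,
      fderiv ℝ (Kerr.bilin M a) P (A P + d) (E4.basisVector 0) (E4.basisVector ν) +
        Kerr.bilin M a P (A (E4.basisVector 0)) (E4.basisVector ν) +
        Kerr.bilin M a P (E4.basisVector 0) (A (E4.basisVector ν)) = 0) :
    A (E4.basisVector 0) = 0 ∧ d 1 = 0 ∧ d 2 = 0 ∧ d 3 = 0 ∧ (a ≠ 0 → A (E4.basisVector 3) = 0) := by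
  have hv1 : v₃ < 1 := (abs_lt.1 hv).2
  have hv2 : -1 < v₃ := (abs_lt.1 hv).1
  have ha2 : a ^ 2 ≤ z ^ 2 / 9 := by
    have : |a| ≤ z / 3 := by linarith
    have h := sq_le_sq' (by linarith [abs_nonneg a]) this
    rw [sq_abs] at h; linarith [h]
  refine axisKernel_three_points A d hM hA P₁ P₂ P₃ ?_ ?_ ?_ ?_ ?_ ?_ ?_ ?_ ?_ ?_ ?_ hvan <;>
    simp only [hP₁, hP₂, hP₃] <;> simp
  · exact hz
  · linarith
  · exact hz
  · intro h
    have : z * (1 - v₃) = 0 := by linarith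
    rcases mul_eq_zero.1 this with h1 | h1 <;> linarith
  · intro h
    have key : 0 < 4 * (2 + v₃) * z ^ 4 - (18 + 5 * v₃) * a ^ 2 * z ^ 2 - (2 - v₃) * a ^ 4 := by
      have hz4 : 0 < z ^ 4 := by positivity
      have k1 : 4 * z ^ 4 ≤ 4 * (2 + v₃) * z ^ 4 := by nlinarith [hz4.le]
      have k2 : (18 + 5 * v₃) * a ^ 2 * z ^ 2 ≤ 23 * (a ^ 2 * z ^ 2) := by
        nlinarith [mul_nonneg (sq_nonneg a) (sq_nonneg z)]
      have k3 : (2 - v₃) * a ^ 4 ≤ 3 * a ^ 4 := by nlinarith [pow_nonneg (sq_nonneg a) 2, sq_nonneg a]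
      have k4 : a ^ 2 * z ^ 2 ≤ z ^ 4 / 9 := by nlinarith [sq_nonneg z]
      have k5 : a ^ 4 ≤ z ^ 4 / 81 := by
        have := mul_le_mul ha2 ha2 (sq_nonneg a) (by positivity)
        nlinarith [this]
      nlinarith [k1, k2, k3, k4, k5, hz4]
    have hzero : z * (4 * (2 + v₃) * z ^ 4 - (18 + 5 * v₃) * a ^ 2 * z ^ 2 - (2 - v₃) * a ^ 4) = 0 := by
      linear_combination h
    rcases mul_eq_zero.1 hzero with h1 | h1 <;> linarith

end Kernel

/-- Registered carrier `slaving_axisKernel_slaving12` of the crux item (= `axisKernel_slab`). [folklore] -/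
theorem slaving_axisKernel_slaving12 : open Literature.Geometry.Lorentzian in ∀ {M a : ℝ} (A : E4 →L[ℝ] E4) (d : E4), M ≠ 0 → (∀ u w : E4, Minkowski.bilin (A u) w + Minkowski.bilin u (A w) = 0) → ∀ {z v₃ : ℝ}, 0 < z → 3 * |a| ≤ z → |v₃| < 1 → ∀ (P₁ P₂ P₃ : E4), P₁ = ![-(v₃ * z), 0, 0, z] → P₂ = ![-(v₃ * (2 * z)), 0, 0, 2 * z] → P₃ = ![v₃ * z, 0, 0, -z] → (∀ P ∈ ({P₁, P₂, P₃} : Set E4), ∀ ν : Fin 4, fderiv ℝ (Kerr.bilin M a) P (A P + d) (E4.basisVector 0) (E4.basisVector ν) + Kerr.bilin M a P (A (E4.basisVector 0)) (E4.basisVector ν) + Kerr.bilin M a P (E4.basisVector 0) (A (E4.basisVector ν)) = 0) → A (E4.basisVector 0) = 0 ∧ d 1 = 0 ∧ d 2 = 0 ∧ d 3 = 0 ∧ (a ≠ 0 → A (E4.basisVector 3) = 0) :=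
  fun A d hM hA _ _ hz hza hv P₁ P₂ P₃ h1 h2 h3 hvan ↦
    axisKernel_slab A d hM hA hz hza hv P₁ P₂ P₃ h1 h2 h3 hvan

end Summit.FinalStateConjecture.FinalStateConjecture.Theorems.SublinearIsFree.Slaving
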